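import Mathlib
import HarnessLib
import Summits.QuantumFields.YangMills.Theorems.MirrorModularBoostsSoftKernelBoostCovarianceOfAxisRow
import Summits.QuantumFields.YangMills.Theses.MirrorModularBoosts
import Summits.QuantumFields.YangMills.Theses.IsotropyFromPowerCounting

/-!
# Line `axis-row` — crux stmt-QuantumFields-14999 `SoftKernelBoostCovariance` (B′) (registration of the line of record `Sketch` v3.13,
line-writer seat, 2026-08-31)

HONEST FRAMING (director-ym R645-ym, verbatim obligation). Route MirrorModularBoosts (r3, the only route wanting B′) concludes `YangMills`
only through its `WeakCouplingHypercubicLimit`-type existence leg, which stays OPEN and summit-strength; this registered skeleton is a typed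
plan for ONE leaf, not progress on the Clay problem; the Yang–Mills mass gap is NOT proved. Both stubs below are Yang–Mills INPUTS shared
with sibling cruxes (T = stmt-17721, Σ = stmt-18372) — typed, led under their own items, not claimed here.

STATE OF THE LEAF (leads c0–c18, 2026-08-16/17; `PICKED.md`, `Lines/Sketch.md`). The line of record `Lines/Sketch.lean` v3.13 (2079 lines,
never landable whole; imports ≈ 50 Theorems modules, several of whose hub oleans are UNBUILT today ⇒ the file cannot be elaborated, and its
registered path was a swept session folder) is sorry-free except for TWO stubs, and its closing composition is LANDED and importable:
`Theorems/MirrorModularBoostsSoftKernelBoostCovarianceOfAxisRow.lean` (p164803) proves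
`Sketch.stub_cruxOfAxisRow : (stub_regularHigh text) → (stub_sandwichAxis text) → MirrorModularBoosts.SoftKernelBoostCovariance`
(Step 0 by degrees p142709 ⇒ `NPointRegular`; the 45° sandwich row from the AXIS row model-blindly, `diag_of_axis` over the landed diagonal-chain
stubs p162400/p158796/p160140; the pointwise composition `cruxOfInputsKWeak` p143258). That module's import closure IS built on the hub today
(probe rc 0), so THIS FILE re-registers v3.13's exact residual, importable and kernel-checked, with the SAME stub names and VERBATIM stub texts:
* `stub_regularHigh` — for `n ≥ 3`, `𝔖ₙ|⁰𝒮` of the curvature channel is integration against a function, under `W1` + eight frames + cone +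
  kernel triple. Strictly WEAKER than item T (`regularHigh_of_temperedCurvatureMoments`, p142709; see `example` below) and than item
  `CurvatureDensities` (stmt-17723). USES THE TIE (junk violates it: `not_nPointRegular_junk`). Size XL (UV regularity of the Wilson limit).
* `stub_sandwichAxis` — the AXIS heat-sandwich row `SandwichRows S₁` under the same hypotheses = the first row of item Σ, which is EQUIVALENT
  to Σ (`curvatureSandwichBound_iff_axisRows`, p166596) = the Σ-lead's leaf `stub_chainGrowthAxis`. THE BET of the route; size XL = the UV
  sandwich bound at weak coupling (see Σ's line card `Cruxes/CurvatureSandwichBound/Lines/coupling_trichotomy.md`: model-blind derivations are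
  dead — `ConvexityBarrier` p172808, random constant field p172442).
`SoftKernelBoostCovariance_of : MirrorModularBoosts.SoftKernelBoostCovariance := Sketch.stub_cruxOfAxisRow stub_regularHigh stub_sandwichAxis`
is the ONLY theorem here concluding the crux decl (audit-unambiguous); `sorry` occurs EXACTLY in the two `stub_*`. The by-name recipe when both
sibling items close is the landed `Sketch.softKernelBoostCovariance_of_items' : TemperedCurvatureMoments → CurvatureSandwichBound →
SoftKernelBoostCovariance` (checked below as an `example`). Why not the K/Σ coupling trichotomy here: it would only re-scope the universal
quantifier; the leaf's real structure is «B′ ⇐ {regularity n ≥ 3, axis row}», already kernel-checked, so that is what is registered.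
Negatives honoured: `Disproof.lean` §1 (`softKernelBoostCovariance_false_without_tie/_tieAt4/_lattice`: the tie is load-bearing — both stubs
keep `W1 ∋ Tie`), §3 (`not_softKernelBoostCovarianceOnAllTests`: conclusion stays on `⁰𝒮`), §5 (junk kills tie-free versions of both stubs:
`sandwichBound_junk`, `not_nPointRegular_junk` — both stubs carry the tie); refuted stmt-9665-type universality is not touched (no sign claim).
-/

noncomputable section

namespace Summit.QuantumFields.YangMills.Cruxes.SoftKernelBoostCovariance.AxisRow

/-! ## Registered stubs `stub_<name>` (`sorry` lives ONLY here; names and texts = line `Sketch` v3.13) -/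

/-- **Stub `stub_regularHigh`** (v3.10–v3.13 text, verbatim): for `n ≥ 3`, `𝔖ₙ|⁰𝒮` is integration against a function. Yang–Mills input
(⇐ item T, stmt-17721, by `regularHigh_of_temperedCurvatureMoments`). Size XL. [OsterwalderSchrader1973 §2; GlimmJaffe1987 §6.1] -/
theorem stub_regularHigh :
    
    open Literature.MathematicalPhysics.QuantumLattice Literature.MathematicalPhysics.AQFT
      Literature.MathematicalPhysics.QuantumFieldTheory
      Summit.QuantumFields.YangMills.Theorems.CurvatureBoostCovariance.Negative
      Summit.QuantumFields.YangMills.Theorems.CurvatureSandwichBound.Negative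
      Summit.QuantumFields.YangMills.Theorems.NPointIsotropy.Negative in
∀ (G : Type) [Group G] [TopologicalSpace G] [IsTopologicalGroup G] [CompactSpace G]
      [MeasurableSpace G] [BorelSpace G], IsCompactSimpleLieGroup G →
      ∀ (r : LatticeRep G) (sch : SpeciesScheme (YMSpecies G)) (S₁ : SchwingerFamily E4),
        W1 r sch S₁ → EightFrameRP S₁ → PlanarCone S₁ →
        (∃ (K : E4 → ℝ) (C η : ℝ), 0 < η ∧ ContinuousOn K {x : E4 | x ≠ 0} ∧
          (∀ x : E4, x ≠ 0 → |K x| ≤ C * (1 + ‖x‖ ^ (η - 10))) ∧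
          ∀ F : SchwartzMap (Fin 2 → E4) ℂ, IsOffDiagonal F →
            MeasureTheory.Integrable (fun x : Fin 2 → E4 => (K (x 0 - x 1) : ℂ) * F x) ∧
              S₁ 2 F = ∫ x : Fin 2 → E4, (K (x 0 - x 1) : ℂ) * F x) →
        ∀ n : ℕ, 3 ≤ n → ∃ W : (Fin n → E4) → ℂ, ∀ F : SchwartzMap (Fin n → E4) ℂ, IsOffDiagonal F →
          MeasureTheory.Integrable (fun y : Fin n → E4 => W y * F y) ∧ S₁ n F = ∫ y : Fin n → E4, W y * F y := by
  sorry

/-- **Stub `stub_sandwichAxis`** (v3.12–v3.13 text, verbatim): the AXIS heat-sandwich row `SandwichRows S₁` — THE BET (= item Σ, stmt-18372, by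
`curvatureSandwichBound_iff_axisRows` p166596). Size XL. [GlimmJaffe1987 §19.5; OsterwalderSchrader1975 §4] -/
theorem stub_sandwichAxis :
    
    open Literature.MathematicalPhysics.QuantumLattice Literature.MathematicalPhysics.AQFT
      Literature.MathematicalPhysics.QuantumFieldTheory
      Summit.QuantumFields.YangMills.Theorems.CurvatureBoostCovariance.Negative
      Summit.QuantumFields.YangMills.Theorems.CurvatureSandwichBound.Negative
      Summit.QuantumFields.YangMills.Theorems.NPointIsotropy.Negative in
∀ (G : Type) [Group G] [TopologicalSpace G] [IsTopologicalGroup G] [CompactSpace G]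
      [MeasurableSpace G] [BorelSpace G], IsCompactSimpleLieGroup G →
      ∀ (r : LatticeRep G) (sch : SpeciesScheme (YMSpecies G)) (S₁ : SchwingerFamily E4),
        W1 r sch S₁ → EightFrameRP S₁ → PlanarCone S₁ →
        (∃ (K : E4 → ℝ) (C η : ℝ), 0 < η ∧ ContinuousOn K {x : E4 | x ≠ 0} ∧
          (∀ x : E4, x ≠ 0 → |K x| ≤ C * (1 + ‖x‖ ^ (η - 10))) ∧
          ∀ F : SchwartzMap (Fin 2 → E4) ℂ, IsOffDiagonal F →
            MeasureTheory.Integrable (fun x : Fin 2 → E4 => (K (x 0 - x 1) : ℂ) * F x) ∧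
              S₁ 2 F = ∫ x : Fin 2 → E4, (K (x 0 - x 1) : ℂ) * F x) →
        SandwichRows S₁ := by
  sorry

/-! ## Composition (kernel-checked; no `sorry` below this line) -/

/-- **Composition `SoftKernelBoostCovariance_of`**: the two registered stubs give the crux BY NAME through the LANDED closing composition
`Sketch.stub_cruxOfAxisRow` (p164803). The ONLY theorem in this file whose conclusion is the crux decl. [folklore] -/
theorem SoftKernelBoostCovariance_of : Summit.QuantumFields.YangMills.Theses.MirrorModularBoosts.SoftKernelBoostCovariance :=
  Summit.QuantumFields.YangMills.Theorems.SoftKernelBoostCovariance.Sketch.stub_cruxOfAxisRow stub_regularHigh stub_sandwichAxis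

/-- Sanity (by-name recipe, landed p164803): the two sibling ITEMS close the crux — T (stmt-17721) and Σ (stmt-18372). An `example`, so the
skeleton audit sees a single crux-concluding theorem. [folklore] -/
example (hT : Summit.QuantumFields.YangMills.Theses.IsotropyFromPowerCounting.TemperedCurvatureMoments)
    (hSig : Summit.QuantumFields.YangMills.Theses.IsotropyFromPowerCounting.CurvatureSandwichBound) :
    Summit.QuantumFields.YangMills.Theses.MirrorModularBoosts.SoftKernelBoostCovariance :=
  Summit.QuantumFields.YangMills.Theorems.SoftKernelBoostCovariance.Sketch.softKernelBoostCovariance_of_items' hT hSig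

/-- Sanity: item Σ alone discharges `stub_sandwichAxis`'s role (its axis row only), given `stub_regularHigh`. [folklore] -/
example (hSig : Summit.QuantumFields.YangMills.Theses.IsotropyFromPowerCounting.CurvatureSandwichBound) :
    Summit.QuantumFields.YangMills.Theses.MirrorModularBoosts.SoftKernelBoostCovariance :=
  Summit.QuantumFields.YangMills.Theorems.SoftKernelBoostCovariance.Sketch.softKernelBoostCovariance_of_regularHigh_of_item'
    stub_regularHigh hSig

end Summit.QuantumFields.YangMills.Cruxes.SoftKernelBoostCovariance.AxisRow

end
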